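import Summits.CriticalPhenomena.PercolationContinuityZ3.Theorems.FK.Transplant.KNFreePinningWorstCase
import Literature.Probability.LatticeModels.RandomClusterEmbedding
import Literature.Probability.LatticeModels.RandomClusterEdgeWeightsHomogeneous
import HarnessLib

/-!
# FK-continuity transplant, FT-05 (iv): every look of the exploration is an instance of FH —
# a sub-box law with its seed wired, read inside a history-conditioned arena law along an embedding

Cell `fk-continuity` (bschramm), FRONTIER TRANSPLANT sub-cell, registry row FT-05 (`KNFreePinning`, part iv: the FK
replacement of `restrW`/`wireW` of `Literature/Probability/Percolation/KozmaNitzanPinning.lean`); support file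
(`--supports stmt-CriticalPhenomena-4575`); builds on p205010 (kernel theorem, internal audit signed; external
expert review pending). HONEST FRAMING: the transplant `ufsc0_of_freeBoundaryHypothesis_r0` this file serves is
CONDITIONAL on the free-boundary penetration hypothesis FH (open at the same `p` for `q > 1`; ⇔ GRC Conj. (5.103)
via the referee's calibration K1; barrier note `SamePFreeBoundaryCriteria`, Literature/Barriers/CriticalPhenomena);
it is a typed reduction, not a proof of FK continuity. THIS file is unconditional finite-volume measure theory:
no named facts, no sorries, standard axioms; nothing here is specific to `q = 2` or to `d = 3`.

## What is here

The hypothesis FH and the corridor/penetration estimates of the transplant are statements about the random-cluster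
measure `φ^{W₀}_{H,p,q} = rcMeasure H p q W₀` of a FIXED finite graph `H` (a box `Λ_L` of `ℤ^d`, a corridor) with a
seed `W₀` wired and free boundary elsewhere. The exploration, on the other hand, runs in a big finite arena `U`
(a graph `G` with parameters `w = p · 1_{E(G)}`) and at each look the law of the not-yet-revealed edges is a
history-conditioned law `φ^B_{condWeights w F ξ, q}` (`KNFreePinning.lean`): fresh region `F`, revealed-open edges
`ξ`, everything else deleted. Placing the box in the arena is an injection `j : V₀ ↪ U` mapping the edges of `H`
to fresh arena edges of parameter `p`; the seed `j(W₀)` lies inside the current (revealed, hence wired-into-itself)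
cluster. Then for every increasing event `A` of the box configuration (`q ≥ 1`):

  `φ^{W₀}_{H,p,q}(A) ≤ φ^B_{condWeights w F ξ, q}(ρ_j⁻¹ A)`, `ρ_j = restrictConfig j`

(`rcMeasure_real_le_condWeights_real_preimage_restrictConfig`): the probability, under the history-conditioned
arena law, that the configuration READ INSIDE THE PLACED BOX lies in `A` is at least the box's own seeded free
probability of `A`. With `A` = "the seed is joined to the far face inside the box" the right-hand side is what
KN's Lemma 12 / Theorem 6 Step IV consume and the left-hand side is what FH bounds from below (memo A §3.2,
memo B addendum §1.2–1.3, REFUTER-REPORT §8 F2/F4). Ingredients: the identification of the box law with the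
arena law "fresh on the image edges, everything else deleted, `j(W₀)` wired"
(`rcMeasure_map_eq_rcMeasureW_condWeights`, from the tree's `rcMeasure_real_restrictConfig_preimage_image` and
`rcMeasure_eq_rcMeasureW`), the worst-case comparison `rcMeasureW_condWeights_empty_real_le`
(`KNFreePinningWorstCase.lean`) and region monotonicity (`KNFreePinning.lean`). Also: open paths read inside the
box are open paths of the arena (`reachable_map_of_reachable_restrictConfig`), so box-internal connection events
pull back into arena connection events.

## References

* G. Grimmett, *The Random-Cluster Model*, Springer 2006: §4.2 (4.11)–(4.13), Lemma (4.13) p. 71, Lemma (4.14)(b)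
  p. 72; eq. (1.20). [Grimmett2006]
* G. Kozma, S. Nitzan, arXiv:2401.12397 (2024), §4: Lemma 12 p. 23–24, (30) p. 27, Step IV pp. 30–31.
  [KozmaNitzan2024]
-/

noncomputable section

open MeasureTheory Finset SimpleGraph
open scoped ENNReal Classical

namespace Summit.CriticalPhenomena.PercolationContinuityZ3.Theorems.FK

open Literature.Probability.Percolation (BondConfig openGraph restrictConfig mem_restrictConfig)
open Literature.Probability.LatticeModels

section Region

variable {V₀ U : Type*} [Fintype V₀] [DecidableEq V₀] [Fintype U] [DecidableEq U] (j : V₀ ↪ U)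
  (H : SimpleGraph V₀) [DecidableRel H.Adj] (w : Sym2 U → unitInterval)

omit [Fintype V₀] [DecidableEq V₀] [Fintype U] [DecidableEq U] [DecidableRel H.Adj] in
/-- **The placed box inside the arena, as conditional parameters**: if the arena parameters equal `p` on the image
edges of `H`, then "fresh on `E(j H)`, everything else deleted" is the homogeneous parameter vector
`p · 1_{E(j H)}` of the image graph. [cite: Grimmett2006, §1.4 eq. (1.20) (p. 15)] -/
theorem condWeights_edgeSet_map_empty (p : unitInterval) (hw : ∀ e ∈ H.edgeSet, w (j.sym2Map e) = p) :
    condWeights w (H.map j).edgeSet ∅ = edgeIndicatorWeights (H.map j) p := by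
  funext e
  by_cases he : e ∈ (H.map j).edgeSet
  · rw [condWeights_of_mem w ∅ he]
    unfold edgeIndicatorWeights
    rw [if_pos he]
    rw [SimpleGraph.edgeSet_map] at he
    obtain ⟨e₀, he₀, rfl⟩ := he
    exact hw e₀ he₀
  · rw [condWeights_of_not_mem_of_not_mem w he (Set.notMem_empty e)]
    unfold edgeIndicatorWeights
    rw [if_neg he]

omit [DecidableEq V₀] in
/-- **The law of the placed box is a history-conditioned arena law**: `φ^W_{jH,p,q} = φ^W_{condWeights w E(jH) ∅, q}`
whenever the arena parameters are `p` on the image edges (`0 < q`). [cite: Grimmett2006, §1.4 eq. (1.20) (p. 15)] -/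
theorem rcMeasure_map_eq_rcMeasureW_condWeights (p : unitInterval) {q : ℝ} (hq : 0 < q)
    (hw : ∀ e ∈ H.edgeSet, w (j.sym2Map e) = p) (W : Set U) :
    rcMeasure (H.map j) p q W = rcMeasureW (condWeights w (H.map j).edgeSet ∅) q W := by
  rw [condWeights_edgeSet_map_empty j H w p hw]
  exact rcMeasure_eq_rcMeasureW (H.map j) p hq W

omit [Fintype V₀] [DecidableEq V₀] [Fintype U] [DecidableEq U] [DecidableRel H.Adj] in
/-- Reading a configuration inside the placed box is monotone: `restrictConfig j` pulls increasing events back to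
increasing events. [folklore] -/
theorem isUpperSet_preimage_restrictConfig {A : Set (BondConfig V₀)} (hA : IsUpperSet A) :
    IsUpperSet (restrictConfig j ⁻¹' A : Set (BondConfig U)) :=
  fun _ _ hle hω => hA (fun _ he => hle he) hω

omit [Fintype V₀] [DecidableEq V₀] [Fintype U] [DecidableEq U] [DecidableRel H.Adj] in
/-- **Open paths read inside the box are open paths of the arena**: if `x, y` are joined by a path of edges of the
box that are open in `ω` (i.e. in `openGraph (restrictConfig j ω)`), then `j x, j y` are joined in `openGraph ω`.
[folklore] -/
theorem reachable_map_of_reachable_restrictConfig (ω : BondConfig U) {x y : V₀}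
    (h : (openGraph (restrictConfig j ω)).Reachable x y) : (openGraph ω).Reachable (j x) (j y) := by
  let φ : openGraph (restrictConfig j ω) →g openGraph ω :=
    { toFun := j
      map_rel' := by
        intro a b hab
        rw [Literature.Probability.Percolation.openGraph_adj] at hab ⊢
        exact ⟨(mem_restrictConfig j ω s(a, b)).1 hab.1, fun h' => hab.2 (j.injective h')⟩ }
  exact h.map φ

/-- **Every look of the exploration is an instance of FH** (memo A §3.2, memo B addendum §1.2; Grimmett 2006,
Lemma (4.13) with (4.14)(b), lower half, in the tree's formalism). Let `j : V₀ ↪ U` place the finite graph `H`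
in the arena so that the arena parameters are `p` on the image edges, let the image edges be fresh
(`E(jH) ⊆ F`), the revealed-open set `ξ` disjoint from `F`, and the seed `j(W₀)` lie inside ONE cluster of
`⟨ξ⟩ ∨ K_B`. Then for `0 ≤ p ≤ 1`, `q ≥ 1` and every increasing event `A` of configurations of `H`,
`φ^{W₀}_{H,p,q}(A) ≤ φ^B_{condWeights w F ξ, q}(restrictConfig j ⁻¹' A)`: the history-conditioned probability
that the configuration read inside the placed box lies in `A` is at least the box's own probability of `A` with
the seed wired and free boundary. [cite: Grimmett2006, Lemma (4.13) p. 71 and Lemma (4.14)(b) p. 72] -/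
theorem rcMeasure_real_le_condWeights_real_preimage_restrictConfig {p : ℝ} (hp : p ∈ Set.Icc (0 : ℝ) 1)
    {q : ℝ} (hq : 1 ≤ q) (hw : ∀ e ∈ H.edgeSet, ((w (j.sym2Map e) : unitInterval) : ℝ) = p)
    {F ξ : Set (Sym2 U)} (hF : (H.map j).edgeSet ⊆ F) (hξ : Disjoint ξ F) {B : Set U} {W₀ : Set V₀}
    (hW : ∀ x ∈ W₀, ∀ y ∈ W₀, (openGraph ξ ⊔ wired B).Reachable (j x) (j y))
    {A : Set (BondConfig V₀)} (hA : IsUpperSet A) :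
    (rcMeasure H p q W₀).real A ≤ (rcMeasureW (condWeights w F ξ) q B).real (restrictConfig j ⁻¹' A) := by
  have hq0 : 0 < q := one_pos.trans_le hq
  set p' : unitInterval := ⟨p, hp⟩ with hp'
  have hw' : ∀ e ∈ H.edgeSet, w (j.sym2Map e) = p' := fun e he => Subtype.ext (hw e he)
  have hE : (H.map j).edgeFinset = H.edgeFinset.map j.sym2Map := by
    convert SimpleGraph.edgeFinset_map j H
  have h0 : (rcMeasure H p q W₀).real A =
      (rcMeasure (H.map j) p q (j '' W₀)).real (restrictConfig j ⁻¹' A) :=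
    (rcMeasure_real_restrictConfig_preimage_image j hE hp hq0 W₀ A).symm
  have hA' : IsUpperSet (restrictConfig j ⁻¹' A : Set (BondConfig U)) := isUpperSet_preimage_restrictConfig j hA
  have hjW : ∀ x ∈ j '' W₀, ∀ y ∈ j '' W₀, (openGraph ξ ⊔ wired B).Reachable x y := by
    rintro _ ⟨x₀, hx₀, rfl⟩ _ ⟨y₀, hy₀, rfl⟩
    exact hW x₀ hx₀ y₀ hy₀
  rw [h0, show (p : ℝ) = ((p' : unitInterval) : ℝ) from rfl,
    rcMeasure_map_eq_rcMeasureW_condWeights j H w p' hq0 hw' (j '' W₀)]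
  calc (rcMeasureW (condWeights w (H.map j).edgeSet ∅) q (j '' W₀)).real (restrictConfig j ⁻¹' A)
      ≤ (rcMeasureW (condWeights w (H.map j).edgeSet ξ) q B).real (restrictConfig j ⁻¹' A) :=
        rcMeasureW_condWeights_empty_real_le w hq (hξ.mono_right hF) hjW hA'
    _ ≤ (rcMeasureW (condWeights w F ξ) q B).real (restrictConfig j ⁻¹' A) :=
        rcMeasureW_condWeights_real_mono_left w hq B hF hξ hA'

/-- The same with the seed a single vertex (no reachability hypothesis): a one-point wired set is no wiring, so this
compares the FREE law of the placed box with every history-conditioned arena law.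
[cite: Grimmett2006, Lemma (4.13) p. 71 and Lemma (4.14)(b) p. 72] -/
theorem rcMeasure_real_le_condWeights_real_preimage_restrictConfig_singleton {p : ℝ}
    (hp : p ∈ Set.Icc (0 : ℝ) 1) {q : ℝ} (hq : 1 ≤ q)
    (hw : ∀ e ∈ H.edgeSet, ((w (j.sym2Map e) : unitInterval) : ℝ) = p)
    {F ξ : Set (Sym2 U)} (hF : (H.map j).edgeSet ⊆ F) (hξ : Disjoint ξ F) (B : Set U) (x₀ : V₀)
    {A : Set (BondConfig V₀)} (hA : IsUpperSet A) :
    (rcMeasure H p q {x₀}).real A ≤ (rcMeasureW (condWeights w F ξ) q B).real (restrictConfig j ⁻¹' A) :=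
  rcMeasure_real_le_condWeights_real_preimage_restrictConfig j H w hp hq hw hF hξ
    (fun x hx y hy => by
      rw [Set.mem_singleton_iff] at hx hy
      subst hx; subst hy
      exact SimpleGraph.Reachable.refl _) hA

end Region

end Summit.CriticalPhenomena.PercolationContinuityZ3.Theorems.FK

end
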